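import Literature.NumberTheory.EllipticCurves.BhargavaHo2022.TwoMarkedPoints
import Literature.NumberTheory.EllipticCurves.DivisionValuesSigmaFormulaProofs
import HarnessLib

/-!
# BirchSwinnertonDyer / CountingDoorF2AtThree — crux I4loc `SchneiderOnDoorSubfamily`
# (stmt-BirchSwinnertonDyer-19682), line `valuation-class-at-three`: the S2 input
# (exact denominator / sigma formula in division values) for the marked points of `F₂`

Helper file (`--supports stmt-BirchSwinnertonDyer-19682 --as helper`; cell bsd-rank2, seat
cd-valclass-denom; PARTITION: none — r_an ≥ 2, summit axis S0). It specialises the tree's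
division-value package (`Literature/NumberTheory/EllipticCurves/DivisionValuesNonsingularReductionProofs`,
Ayad's lemma and `den x(nP) = ψₙ(P)²`; `…/DivisionValuesSigmaFormulaProofs`, the sigma formula for
`⟨nP, nP⟩` in integer division values) to a member `a = (a₁, a₂, a₂', a₃)` of Bhargava–Ho's family `F₂`,

  `E_a : y² + a₁xy + a₃y = (x − a₂)(x − a₂')(x + a₂ + a₂')`  (`Params.curve = Params.curveInt ⊗ ℚ`),

and its INTEGRAL marked points `P₁ = (a₂, 0)`, `P₂ = (a₂', 0)` (`Params.markedPoint₁/₂`), under the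
line's sieve hypothesis «`Δ(a)` is divisible by the square of no prime» (= door class `Φ₀` ∩
{`ℓ² ∤ Δ(a)`}: every bad fibre is I₁, so EVERY rational point reduces non-singularly at EVERY prime —
memo HOME/p2/PADIC-R2-G11.md §2.1 «type ∅»). For `n` with `3 ∣ ψₙ(Pᵢ) ≠ 0` (e.g. `n = 6 = #Ẽ(𝔽₃)` on
the door class, or eng-2's minimal multipliers `n = 2` for `P₁`, `n = 3` for `P₂`) and every CANONICAL
`3`-adic height datum `Dh` on `a.curve`:

* `n • Pᵢ = (φₙ/ψₙ², ωₙ/ψₙ³)` with the integers `ψₙ(Pᵢ) = (a.curveInt.ψ n).evalEval aᵢ 0`, …;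
  `den x(n • Pᵢ) = ψₙ(Pᵢ)²`, `num x(n • Pᵢ) = φₙ(Pᵢ)` (memo §2.2: `e_Q = |ψ_N(Q;a)|`);
* `n • Pᵢ` is ADMISSIBLE at `3`, `φₙ(Pᵢ), ωₙ(Pᵢ) ∈ ℤ₃ˣ`, `z(n • Pᵢ) = −φₙψₙ/ωₙ` with `‖z‖₃ = ‖ψₙ(Pᵢ)‖₃`
  (memo: `t_Q = −φψ/ω`, `k_Q = v₃(ψ)`, `u_Q = ∓ω/φ ∈ ℤ₃ˣ`);
* `Dh.pairing (n • Pᵢ) (n • Pᵢ) = log₃ ψₙ(Pᵢ)² − 2 log₃ σ₃(−φₙψₙ/ωₙ)` and `n² · Dh.pairing Pᵢ Pᵢ =` the same;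
  first order: `‖Dh.pairing (n • Pᵢ) (n • Pᵢ) − log₃ φₙ(Pᵢ)‖₃ ≤ ‖ψₙ(Pᵢ)‖₃`;
* the first division values in the parameters: `ψ₂(P₁) = a₁a₂ + a₃`, `ψ₂(P₂) = a₁a₂' + a₃`.

Everything is stated for an arbitrary integral point `(u, v)` of `a.curve` first (so `P₁ + P₂ =
(−a₂−a₂', a₁(a₂+a₂') − a₃)` or any other integral point is covered) and then for `P₁`, `P₂`; `ℕ`-scalar
forms (`m • Pᵢ`, the shape `6 • a.markedPoint₁ h` of the registered skeleton
`Cruxes/SchneiderOnDoorSubfamily/Lines/valuation_class_at_three.lean`) are given as corollaries.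
B1 honesty: local algebra of division polynomials and the definition of the canonical height; nothing
here mentions a Selmer group, an `L`-value or an analytic rank.

References: Mazur–Stein–Tate 2006 §1, Alg. 3.4 [MazurSteinTate2006]; Stange 2016 §5 [Stange2016];
Bhargava–Ho 2022 §1 [BhargavaHo2022]; Silverman *AEC* Ex. 3.7 [SilvermanAEC2009].
-/

-- the summit namespace `Summit.BirchSwinnertonDyer.BirchSwinnertonDyer.Theorems` repeats a component by design
-- (single-conjunct summit, CONVENTIONS §1), which the `dupNamespace` linter would flag on every declaration.
set_option linter.dupNamespace false

noncomputable section

open scoped Classical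
open WeierstrassCurve Literature.NumberTheory.EllipticCurves
  Literature.NumberTheory.EllipticCurves.BhargavaHo2022

namespace Summit.BirchSwinnertonDyer.BirchSwinnertonDyer.Theorems

variable (a : Params)

/-! ### The sieve: every rational point of a type-∅ member reduces non-singularly everywhere -/

/-- `a.curve` is the base change of the integer model `a.curveInt` (definitional).
[cite: BhargavaHo2022, §1 (definition of F₂)] -/
theorem params_curve_eq_map : a.curve = a.curveInt.map (Int.castRingHom ℚ) := rfl

/-- **Type ∅.** If `Δ(a)` is divisible by the square of no prime (the line's sieve inside the door
class), every rational point of `E_a` has non-singular reduction at every prime `ℓ`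
(`HasNonsingularReductionAt`, the coordinate predicate of the canonical-height files).
[cite: SilvermanAEC2009, VII.2.1 and VII.6.1] -/
theorem params_hasNonsingularReductionAt_of_not_sq_dvd
    (hΔ : ∀ ℓ : ℕ, ℓ.Prime → ¬ (ℓ : ℤ) ^ 2 ∣ a.curveInt.Δ) (ℓ : ℕ) [Fact ℓ.Prime] {x y : ℚ}
    (h : a.curve.toAffine.Nonsingular x y) : a.curve.HasNonsingularReductionAt ℓ x y :=
  a.curveInt.hasNonsingularReductionAt_of_not_sq_dvd_Δ ℓ (hΔ ℓ Fact.out) h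

/-! ### An arbitrary integral point `(u, v)` of `E_a` -/

section IntegralPoint

variable {a} {u v : ℤ}

/-- **`n • (u, v) = (φₙ/ψₙ², ωₙ/ψₙ³)`** with the integer division values of `a.curveInt` at `(u, v)`,
for an integral point of `E_a` and `ψₙ(u, v) ≠ 0`. [cite: SilvermanAEC2009, Exercise 3.7(d)] -/
theorem params_zsmul_intPoint_eq (h : a.curve.toAffine.Nonsingular (u : ℚ) (v : ℚ)) {n : ℤ}
    (hψ : (a.curveInt.ψ n).evalEval u v ≠ 0) :
    ∃ h₁ : a.curve.toAffine.Nonsingular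
        ((((a.curveInt.φ n).evalEval u v : ℤ) : ℚ) / (((a.curveInt.ψ n).evalEval u v : ℤ) : ℚ) ^ 2)
        (((UnivEC.ev a.curveInt u v (UnivEC.ω n) : ℤ) : ℚ) / (((a.curveInt.ψ n).evalEval u v : ℤ) : ℚ) ^ 3),
      n • Affine.Point.some _ _ h = Affine.Point.some _ _ h₁ :=
  Affine.Point.zsmul_some_intCast_eq a.curveInt h hψ

/-- **Exact denominator and numerator of `x(n • (u, v))`** for a type-∅ member:
`den = ψₙ(u,v)²`, `num = φₙ(u,v)`. [cite: Stange2016, §10 Lemma 29 and its proof] -/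
theorem params_den_num_x_zsmul_intPoint (hΔ : ∀ ℓ : ℕ, ℓ.Prime → ¬ (ℓ : ℤ) ^ 2 ∣ a.curveInt.Δ)
    (h : a.curve.toAffine.Nonsingular (u : ℚ) (v : ℚ)) {n : ℤ} (hψ : (a.curveInt.ψ n).evalEval u v ≠ 0) :
    (((((a.curveInt.φ n).evalEval u v : ℤ) : ℚ) / (((a.curveInt.ψ n).evalEval u v : ℤ) : ℚ) ^ 2).den : ℤ) =
        (a.curveInt.ψ n).evalEval u v ^ 2 ∧
      ((((a.curveInt.φ n).evalEval u v : ℤ) : ℚ) / (((a.curveInt.ψ n).evalEval u v : ℤ) : ℚ) ^ 2).num =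
        (a.curveInt.φ n).evalEval u v :=
  ⟨a.curveInt.den_φ_div_ψ_sq_eq h hψ fun ℓ _ _ =>
      a.curveInt.hasNonsingularReductionAt_of_not_sq_dvd_Δ ℓ (hΔ ℓ Fact.out) h,
    a.curveInt.num_φ_div_ψ_sq_eq h hψ fun ℓ _ _ =>
      a.curveInt.hasNonsingularReductionAt_of_not_sq_dvd_Δ ℓ (hΔ ℓ Fact.out) h⟩

variable (p : ℕ) [Fact p.Prime]

/-- **At a prime `p ∣ ψₙ(u, v)`** (type-∅ member, `n ≠ 0`): `φₙ, ωₙ` are `p`-adic units and the parameter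
`z(n • (u,v)) = −φₙψₙ/ωₙ` has `‖z‖_p = ‖ψₙ(u,v)‖_p` (memo §2.2: `u_Q = ∓ω/φ ∈ ℤ_p^×`, `k_Q = v_p(ψ)`).
[cite: Stange2016, §5 proof of Thm 12] -/
theorem params_norm_divisionValues_of_dvd (hΔ : ∀ ℓ : ℕ, ℓ.Prime → ¬ (ℓ : ℤ) ^ 2 ∣ a.curveInt.Δ)
    (h : a.curve.toAffine.Nonsingular (u : ℚ) (v : ℚ)) {n : ℤ} (hn : n ≠ 0)
    (hp : (p : ℤ) ∣ (a.curveInt.ψ n).evalEval u v) :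
    ‖(((a.curveInt.φ n).evalEval u v : ℤ) : ℚ_[p])‖ = 1 ∧
      ‖((UnivEC.ev a.curveInt u v (UnivEC.ω n) : ℤ) : ℚ_[p])‖ = 1 ∧
        ‖-((((a.curveInt.φ n).evalEval u v : ℤ) : ℚ_[p]) * (((a.curveInt.ψ n).evalEval u v : ℤ) : ℚ_[p]) /
            ((UnivEC.ev a.curveInt u v (UnivEC.ω n) : ℤ) : ℚ_[p]))‖ =
          ‖(((a.curveInt.ψ n).evalEval u v : ℤ) : ℚ_[p])‖ := by
  have hred := a.curveInt.hasNonsingularReductionAt_of_not_sq_dvd_Δ p (hΔ p Fact.out) h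
  obtain ⟨hφ, hω⟩ := a.curveInt.norm_intCast_φ_eq_one_of_dvd_ψ p h hred hn hp
  exact ⟨hφ, hω, a.curveInt.norm_padicParam_zsmul_eq p h hred hn hp⟩

/-- **Admissibility** of `n • (u, v)` at `p ≥ 3` for a type-∅ member when `p ∣ ψₙ(u, v) ≠ 0`
(non-torsion, reduces to `O` mod `p`, in the sigma disc, non-singular reduction everywhere).
[cite: MazurSteinTate2006, §1 and Alg. 3.4 (step 1)] -/
theorem params_isAdmissible_zsmul_intPoint (hp3 : 3 ≤ p)
    (hΔ : ∀ ℓ : ℕ, ℓ.Prime → ¬ (ℓ : ℤ) ^ 2 ∣ a.curveInt.Δ)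
    (h : a.curve.toAffine.Nonsingular (u : ℚ) (v : ℚ)) {n : ℤ}
    (hψ : (a.curveInt.ψ n).evalEval u v ≠ 0) (hp : (p : ℤ) ∣ (a.curveInt.ψ n).evalEval u v) :
    a.curve.IsAdmissible p (n • Affine.Point.some _ _ h) :=
  a.curveInt.isAdmissible_zsmul_of_dvd_ψ p hp3 h hΔ hψ hp

/-- **The sigma formula for `⟨n • (u,v), n • (u,v)⟩` on a type-∅ member**, canonical datum `Dh` at
`p ≥ 3`, `p ∣ ψₙ(u,v) ≠ 0`: `= log_p ψₙ² − 2 log_p σ_p(−φₙψₙ/ωₙ)`; together with `n² ⟨Q, Q⟩ = ⟨nQ, nQ⟩`.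
[cite: MazurSteinTate2006, §1 eq. (1.1) and Alg. 3.4 (steps 2–4)] -/
theorem params_pairing_zsmul_intPoint_eq (hp3 : 3 ≤ p) {Dh : PAdicHeightData a.curve p}
    (hDh : Dh.IsCanonical) (hΔ : ∀ ℓ : ℕ, ℓ.Prime → ¬ (ℓ : ℤ) ^ 2 ∣ a.curveInt.Δ)
    (h : a.curve.toAffine.Nonsingular (u : ℚ) (v : ℚ)) {n : ℤ}
    (hψ : (a.curveInt.ψ n).evalEval u v ≠ 0) (hp : (p : ℤ) ∣ (a.curveInt.ψ n).evalEval u v) :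
    Dh.pairing (n • Affine.Point.some _ _ h) (n • Affine.Point.some _ _ h) =
        padicLog p ((((a.curveInt.ψ n).evalEval u v : ℤ) : ℚ_[p]) ^ 2) -
          2 * padicLog p (a.curve.padicSigmaEval p
            (-((((a.curveInt.φ n).evalEval u v : ℤ) : ℚ_[p]) * (((a.curveInt.ψ n).evalEval u v : ℤ) : ℚ_[p]) /
              ((UnivEC.ev a.curveInt u v (UnivEC.ω n) : ℤ) : ℚ_[p])))) ∧
      ((n : ℚ_[p]) ^ 2) * Dh.pairing (Affine.Point.some _ _ h) (Affine.Point.some _ _ h) =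
        Dh.pairing (n • Affine.Point.some _ _ h) (n • Affine.Point.some _ _ h) :=
  ⟨a.curveInt.pairing_zsmul_self_eq_of_isCanonical p hp3 hDh h hΔ hψ hp,
    Dh.sq_mul_pairing_self_eq n _⟩

/-- **First order**: `‖⟨n • (u,v), n • (u,v)⟩ − log_p φₙ(u,v)‖_p ≤ ‖ψₙ(u,v)‖_p` (same hypotheses).
[cite: Harvey2008, §5 (evaluation of log_p(σ_p(mQ)/d(mQ)); Lemma 8)] -/
theorem params_norm_pairing_zsmul_intPoint_sub_le (hp3 : 3 ≤ p) {Dh : PAdicHeightData a.curve p}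
    (hDh : Dh.IsCanonical) (hΔ : ∀ ℓ : ℕ, ℓ.Prime → ¬ (ℓ : ℤ) ^ 2 ∣ a.curveInt.Δ)
    (h : a.curve.toAffine.Nonsingular (u : ℚ) (v : ℚ)) {n : ℤ}
    (hψ : (a.curveInt.ψ n).evalEval u v ≠ 0) (hp : (p : ℤ) ∣ (a.curveInt.ψ n).evalEval u v) :
    ‖Dh.pairing (n • Affine.Point.some _ _ h) (n • Affine.Point.some _ _ h) -
        padicLog p (((a.curveInt.φ n).evalEval u v : ℤ) : ℚ_[p])‖ ≤
      ‖(((a.curveInt.ψ n).evalEval u v : ℤ) : ℚ_[p])‖ :=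
  a.curveInt.norm_pairing_zsmul_self_sub_padicLog_φ_le p hp3 hDh h hΔ hψ hp

end IntegralPoint

/-! ### The marked points `P₁ = (a₂, 0)`, `P₂ = (a₂', 0)` -/

section MarkedPoints

variable {a}

/-- `P₁ = (a₂, 0)` as a point with INTEGER-cast coordinates `((a₂ : ℤ), (0 : ℤ))` (so that the integral-point
lemmas apply verbatim). [cite: BhargavaHo2022, §1 (F₂: marked point (a₂, 0))] -/
theorem params_markedPoint₁_eq_some_intCast (h : a.IsMember) :
    ∃ h' : a.curve.toAffine.Nonsingular ((a.a₂ : ℤ) : ℚ) ((0 : ℤ) : ℚ),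
      a.markedPoint₁ h = Affine.Point.some _ _ h' :=
  UnivEC.some_eq_some_of_eq rfl (Int.cast_zero).symm _

/-- `P₂ = (a₂', 0)` as a point with integer-cast coordinates. [cite: BhargavaHo2022, §1 (F₂: marked point (a₂', 0))] -/
theorem params_markedPoint₂_eq_some_intCast (h : a.IsMember) :
    ∃ h' : a.curve.toAffine.Nonsingular ((a.a₂' : ℤ) : ℚ) ((0 : ℤ) : ℚ),
      a.markedPoint₂ h = Affine.Point.some _ _ h' :=
  UnivEC.some_eq_some_of_eq rfl (Int.cast_zero).symm _

/-- **`ψ₂(P₁) = a₁a₂ + a₃`** (`ψ₂ = 2y + a₁x + a₃` at `(a₂, 0)`): the denominator of `x(2P₁)` is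
`(a₁a₂ + a₃)²` on a type-∅ member. [cite: SilvermanAEC2009, Exercise 3.7(d)] -/
theorem params_ψ_two_markedPoint₁ : (a.curveInt.ψ 2).evalEval a.a₂ 0 = a.a₁ * a.a₂ + a.a₃ := by
  rw [WeierstrassCurve.ψ_two, WeierstrassCurve.ψ₂, Affine.evalEval_polynomialY]
  simp [Params.curveInt]

/-- **`ψ₂(P₂) = a₁a₂' + a₃`.** [cite: SilvermanAEC2009, Exercise 3.7(d)] -/
theorem params_ψ_two_markedPoint₂ : (a.curveInt.ψ 2).evalEval a.a₂' 0 = a.a₁ * a.a₂' + a.a₃ := by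
  rw [WeierstrassCurve.ψ_two, WeierstrassCurve.ψ₂, Affine.evalEval_polynomialY]
  simp [Params.curveInt]

/-- `ψ₃` at an integral point `(u, v)` of `E_a` is `Ψ₃(u) = 3u⁴ + b₂u³ + 3b₄u² + 3b₆u + b₈` of the integer
model (so `ψ₃(P₂) = Ψ₃(a₂')`). [cite: SilvermanAEC2009, Exercise 3.7(d)] -/
theorem params_ψ_three_eval (u v : ℤ) : (a.curveInt.ψ 3).evalEval u v = a.curveInt.Ψ₃.eval u := by
  rw [WeierstrassCurve.ψ_three, Polynomial.evalEval_C]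

/-- **`n • P₁ = (φₙ(P₁)/ψₙ(P₁)², ωₙ(P₁)/ψₙ(P₁)³)`** with the integer division values at `(a₂, 0)`, whenever
`ψₙ(P₁) ≠ 0`. [cite: SilvermanAEC2009, Exercise 3.7(d)] -/
theorem params_zsmul_markedPoint₁_eq (h : a.IsMember) {n : ℤ} (hψ : (a.curveInt.ψ n).evalEval a.a₂ 0 ≠ 0) :
    ∃ h₁ : a.curve.toAffine.Nonsingular
        ((((a.curveInt.φ n).evalEval a.a₂ 0 : ℤ) : ℚ) / (((a.curveInt.ψ n).evalEval a.a₂ 0 : ℤ) : ℚ) ^ 2)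
        (((UnivEC.ev a.curveInt a.a₂ 0 (UnivEC.ω n) : ℤ) : ℚ) / (((a.curveInt.ψ n).evalEval a.a₂ 0 : ℤ) : ℚ) ^ 3),
      n • a.markedPoint₁ h = Affine.Point.some _ _ h₁ := by
  obtain ⟨h', e'⟩ := params_markedPoint₁_eq_some_intCast h
  rw [e']
  exact params_zsmul_intPoint_eq h' hψ

/-- **`n • P₂ = (φₙ(P₂)/ψₙ(P₂)², ωₙ(P₂)/ψₙ(P₂)³)`**, integer division values at `(a₂', 0)`. [cite: SilvermanAEC2009, Exercise 3.7(d)] -/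
theorem params_zsmul_markedPoint₂_eq (h : a.IsMember) {n : ℤ} (hψ : (a.curveInt.ψ n).evalEval a.a₂' 0 ≠ 0) :
    ∃ h₁ : a.curve.toAffine.Nonsingular
        ((((a.curveInt.φ n).evalEval a.a₂' 0 : ℤ) : ℚ) / (((a.curveInt.ψ n).evalEval a.a₂' 0 : ℤ) : ℚ) ^ 2)
        (((UnivEC.ev a.curveInt a.a₂' 0 (UnivEC.ω n) : ℤ) : ℚ) / (((a.curveInt.ψ n).evalEval a.a₂' 0 : ℤ) : ℚ) ^ 3),
      n • a.markedPoint₂ h = Affine.Point.some _ _ h₁ := by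
  obtain ⟨h', e'⟩ := params_markedPoint₂_eq_some_intCast h
  rw [e']
  exact params_zsmul_intPoint_eq h' hψ

variable (p : ℕ) [Fact p.Prime]

/-- **S2 for `P₁` at a prime `p ≥ 3` with `p ∣ ψₙ(P₁) ≠ 0`, type-∅ member, canonical datum `Dh`:**
`n • P₁` is admissible, `⟨nP₁, nP₁⟩ = log_p ψₙ(P₁)² − 2 log_p σ_p(−φₙψₙ/ωₙ)(P₁)`, `n²⟨P₁, P₁⟩ = ⟨nP₁, nP₁⟩`,
and `‖⟨nP₁, nP₁⟩ − log_p φₙ(P₁)‖_p ≤ ‖ψₙ(P₁)‖_p`. [cite: MazurSteinTate2006, §1 eq. (1.1) and Alg. 3.4 (steps 1–4)] -/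
theorem params_pairing_zsmul_markedPoint₁ (hp3 : 3 ≤ p) {Dh : PAdicHeightData a.curve p} (hDh : Dh.IsCanonical)
    (hΔ : ∀ ℓ : ℕ, ℓ.Prime → ¬ (ℓ : ℤ) ^ 2 ∣ a.curveInt.Δ) (h : a.IsMember) {n : ℤ}
    (hψ : (a.curveInt.ψ n).evalEval a.a₂ 0 ≠ 0) (hp : (p : ℤ) ∣ (a.curveInt.ψ n).evalEval a.a₂ 0) :
    a.curve.IsAdmissible p (n • a.markedPoint₁ h) ∧
      Dh.pairing (n • a.markedPoint₁ h) (n • a.markedPoint₁ h) =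
          padicLog p ((((a.curveInt.ψ n).evalEval a.a₂ 0 : ℤ) : ℚ_[p]) ^ 2) -
            2 * padicLog p (a.curve.padicSigmaEval p
              (-((((a.curveInt.φ n).evalEval a.a₂ 0 : ℤ) : ℚ_[p]) *
                  (((a.curveInt.ψ n).evalEval a.a₂ 0 : ℤ) : ℚ_[p]) /
                    ((UnivEC.ev a.curveInt a.a₂ 0 (UnivEC.ω n) : ℤ) : ℚ_[p])))) ∧
        ((n : ℚ_[p]) ^ 2) * Dh.pairing (a.markedPoint₁ h) (a.markedPoint₁ h) =
          Dh.pairing (n • a.markedPoint₁ h) (n • a.markedPoint₁ h) ∧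
          ‖Dh.pairing (n • a.markedPoint₁ h) (n • a.markedPoint₁ h) -
              padicLog p (((a.curveInt.φ n).evalEval a.a₂ 0 : ℤ) : ℚ_[p])‖ ≤
            ‖(((a.curveInt.ψ n).evalEval a.a₂ 0 : ℤ) : ℚ_[p])‖ := by
  obtain ⟨h', e'⟩ := params_markedPoint₁_eq_some_intCast h
  rw [e']
  exact ⟨params_isAdmissible_zsmul_intPoint p hp3 hΔ h' hψ hp,
    (params_pairing_zsmul_intPoint_eq p hp3 hDh hΔ h' hψ hp).1,
    (params_pairing_zsmul_intPoint_eq p hp3 hDh hΔ h' hψ hp).2,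
    params_norm_pairing_zsmul_intPoint_sub_le p hp3 hDh hΔ h' hψ hp⟩

/-- **S2 for `P₂`** (same statement at `(a₂', 0)`). [cite: MazurSteinTate2006, §1 eq. (1.1) and Alg. 3.4 (steps 1–4)] -/
theorem params_pairing_zsmul_markedPoint₂ (hp3 : 3 ≤ p) {Dh : PAdicHeightData a.curve p} (hDh : Dh.IsCanonical)
    (hΔ : ∀ ℓ : ℕ, ℓ.Prime → ¬ (ℓ : ℤ) ^ 2 ∣ a.curveInt.Δ) (h : a.IsMember) {n : ℤ}
    (hψ : (a.curveInt.ψ n).evalEval a.a₂' 0 ≠ 0) (hp : (p : ℤ) ∣ (a.curveInt.ψ n).evalEval a.a₂' 0) :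
    a.curve.IsAdmissible p (n • a.markedPoint₂ h) ∧
      Dh.pairing (n • a.markedPoint₂ h) (n • a.markedPoint₂ h) =
          padicLog p ((((a.curveInt.ψ n).evalEval a.a₂' 0 : ℤ) : ℚ_[p]) ^ 2) -
            2 * padicLog p (a.curve.padicSigmaEval p
              (-((((a.curveInt.φ n).evalEval a.a₂' 0 : ℤ) : ℚ_[p]) *
                  (((a.curveInt.ψ n).evalEval a.a₂' 0 : ℤ) : ℚ_[p]) /
                    ((UnivEC.ev a.curveInt a.a₂' 0 (UnivEC.ω n) : ℤ) : ℚ_[p])))) ∧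
        ((n : ℚ_[p]) ^ 2) * Dh.pairing (a.markedPoint₂ h) (a.markedPoint₂ h) =
          Dh.pairing (n • a.markedPoint₂ h) (n • a.markedPoint₂ h) ∧
          ‖Dh.pairing (n • a.markedPoint₂ h) (n • a.markedPoint₂ h) -
              padicLog p (((a.curveInt.φ n).evalEval a.a₂' 0 : ℤ) : ℚ_[p])‖ ≤
            ‖(((a.curveInt.ψ n).evalEval a.a₂' 0 : ℤ) : ℚ_[p])‖ := by
  obtain ⟨h', e'⟩ := params_markedPoint₂_eq_some_intCast h
  rw [e']
  exact ⟨params_isAdmissible_zsmul_intPoint p hp3 hΔ h' hψ hp,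
    (params_pairing_zsmul_intPoint_eq p hp3 hDh hΔ h' hψ hp).1,
    (params_pairing_zsmul_intPoint_eq p hp3 hDh hΔ h' hψ hp).2,
    params_norm_pairing_zsmul_intPoint_sub_le p hp3 hDh hΔ h' hψ hp⟩

end MarkedPoints

/-! ### `ℕ`-scalar form at `p = 3` (the shape `m • a.markedPointᵢ h` of the registered skeleton) -/

section AtThree

variable {a}

/-- `m • P = (m : ℤ) • P` for points of `E_a` (to pass between the skeleton's `ℕ`-multiples and the
division-polynomial `ℤ`-multiples). [folklore] -/
theorem params_nsmul_eq_zsmul (P : a.curve.toAffine.Point) (m : ℕ) : m • P = (m : ℤ) • P :=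
  (natCast_zsmul P m).symm

/-- **S2 at `p = 3`, `ℕ`-multiples, `P₁`.** For a type-∅ member `a` of `F₂`, `m : ℕ` with
`3 ∣ ψₘ(P₁) ≠ 0` (`ψₘ(P₁) = (a.curveInt.ψ m).evalEval a₂ 0 ∈ ℤ`) and a CANONICAL `3`-adic height datum
`Dh` on `a.curve`: `m • P₁` is admissible and
`Dh.pairing (m • P₁) (m • P₁) = log₃ ψₘ(P₁)² − 2 log₃ σ₃(−φₘψₘ/ωₘ)(P₁) = m² · Dh.pairing P₁ P₁`, with
`‖Dh.pairing (m • P₁) (m • P₁) − log₃ φₘ(P₁)‖₃ ≤ ‖ψₘ(P₁)‖₃`.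
[cite: MazurSteinTate2006, §1 eq. (1.1) and Alg. 3.4 (steps 1–4)] -/
theorem params_pairing_nsmul_markedPoint₁_at_three {Dh : PAdicHeightData a.curve 3} (hDh : Dh.IsCanonical)
    (hΔ : ∀ ℓ : ℕ, ℓ.Prime → ¬ (ℓ : ℤ) ^ 2 ∣ a.curveInt.Δ) (h : a.IsMember) {m : ℕ}
    (hψ : (a.curveInt.ψ m).evalEval a.a₂ 0 ≠ 0) (h3 : (3 : ℤ) ∣ (a.curveInt.ψ m).evalEval a.a₂ 0) :
    a.curve.IsAdmissible 3 (m • a.markedPoint₁ h) ∧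
      Dh.pairing (m • a.markedPoint₁ h) (m • a.markedPoint₁ h) =
          padicLog 3 ((((a.curveInt.ψ m).evalEval a.a₂ 0 : ℤ) : ℚ_[3]) ^ 2) -
            2 * padicLog 3 (a.curve.padicSigmaEval 3
              (-((((a.curveInt.φ m).evalEval a.a₂ 0 : ℤ) : ℚ_[3]) *
                  (((a.curveInt.ψ m).evalEval a.a₂ 0 : ℤ) : ℚ_[3]) /
                    ((UnivEC.ev a.curveInt a.a₂ 0 (UnivEC.ω m) : ℤ) : ℚ_[3])))) ∧
        ((m : ℚ_[3]) ^ 2) * Dh.pairing (a.markedPoint₁ h) (a.markedPoint₁ h) =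
          Dh.pairing (m • a.markedPoint₁ h) (m • a.markedPoint₁ h) ∧
          ‖Dh.pairing (m • a.markedPoint₁ h) (m • a.markedPoint₁ h) -
              padicLog 3 (((a.curveInt.φ m).evalEval a.a₂ 0 : ℤ) : ℚ_[3])‖ ≤
            ‖(((a.curveInt.ψ m).evalEval a.a₂ 0 : ℤ) : ℚ_[3])‖ := by
  rw [params_nsmul_eq_zsmul]
  have := params_pairing_zsmul_markedPoint₁ 3 le_rfl hDh hΔ h hψ h3
  rwa [Int.cast_natCast] at this

/-- **S2 at `p = 3`, `ℕ`-multiples, `P₂`.** [cite: MazurSteinTate2006, §1 eq. (1.1) and Alg. 3.4 (steps 1–4)] -/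
theorem params_pairing_nsmul_markedPoint₂_at_three {Dh : PAdicHeightData a.curve 3} (hDh : Dh.IsCanonical)
    (hΔ : ∀ ℓ : ℕ, ℓ.Prime → ¬ (ℓ : ℤ) ^ 2 ∣ a.curveInt.Δ) (h : a.IsMember) {m : ℕ}
    (hψ : (a.curveInt.ψ m).evalEval a.a₂' 0 ≠ 0) (h3 : (3 : ℤ) ∣ (a.curveInt.ψ m).evalEval a.a₂' 0) :
    a.curve.IsAdmissible 3 (m • a.markedPoint₂ h) ∧
      Dh.pairing (m • a.markedPoint₂ h) (m • a.markedPoint₂ h) =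
          padicLog 3 ((((a.curveInt.ψ m).evalEval a.a₂' 0 : ℤ) : ℚ_[3]) ^ 2) -
            2 * padicLog 3 (a.curve.padicSigmaEval 3
              (-((((a.curveInt.φ m).evalEval a.a₂' 0 : ℤ) : ℚ_[3]) *
                  (((a.curveInt.ψ m).evalEval a.a₂' 0 : ℤ) : ℚ_[3]) /
                    ((UnivEC.ev a.curveInt a.a₂' 0 (UnivEC.ω m) : ℤ) : ℚ_[3])))) ∧
        ((m : ℚ_[3]) ^ 2) * Dh.pairing (a.markedPoint₂ h) (a.markedPoint₂ h) =
          Dh.pairing (m • a.markedPoint₂ h) (m • a.markedPoint₂ h) ∧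
          ‖Dh.pairing (m • a.markedPoint₂ h) (m • a.markedPoint₂ h) -
              padicLog 3 (((a.curveInt.φ m).evalEval a.a₂' 0 : ℤ) : ℚ_[3])‖ ≤
            ‖(((a.curveInt.ψ m).evalEval a.a₂' 0 : ℤ) : ℚ_[3])‖ := by
  rw [params_nsmul_eq_zsmul]
  have := params_pairing_zsmul_markedPoint₂ 3 le_rfl hDh hΔ h hψ h3
  rwa [Int.cast_natCast] at this

end AtThree

end Summit.BirchSwinnertonDyer.BirchSwinnertonDyer.Theorems

end
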